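import Summits.QuantumFields.BalabanUV.Beta.ConstrainedCriticalMap
import Summits.QuantumFields.BalabanUV.Beta.PolarizationTelescopingCompSlice

/-!
# `BalabanUV.Beta.ConstrainedCriticalMapEnvelope` — binder row D1, route (O3), work item W-2 sequel K-U5b: **THE ENVELOPE IDENTITIES**
# (`∇(A ∘ U) = −ω`, `Hess(A ∘ U) = effForm(H_c, C)`: THE STEP FAMILY'S FORM IS THE HESSIAN OF THE TREE-LEVEL EFFECTIVE ACTION), **THE SLICED CRITICAL
# MAP** (prescribed averages `B`, gauge slice value `0`; `U 0 = 0`, `C^k`, `dU(0) = (minOp H [Q; τ]).toCols₁`) **AND THE PLUG INTO K-U2e**: hypothesis (h-U) of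
# `PolarizationTelescopingCompSlice` discharged from VARIATIONAL DATA
# (β sub-cell, BINDER-OWNERS row D1 OWNER, lineage an2 gen 24; sequel of K-U5 `ConstrainedCriticalMap`)

HONEST FRAMING (cell charter, verbatim): «discharging BetaPertH makes Balaban's UV stability UNCONDITIONAL — a real
constructive-QFT result; it is NOT the continuum limit and NOT the Clay problem.»
HONEST DEPENDENCY: continuum YM on T⁴ ⇐ BetaPertH ∧ nine spine estimates (0/9 proved); BetaPertH ⇐ (D1) ∧ (D4) ∧ CAP+tail;
G-an2-4 gates asym, D1 and NE2/3/4.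
ABSOLUTE RULE (cell, verbatim): «No internally-minted statement may enter as a cited fact. Every hypothesis is either kernel-proved in this
package or a verbatim quotation of a PUBLISHED theorem with page reference. The manuscript(s) under audit are NOT citable for their own
disputed steps — they are the thing under adjudication; programme-internal (2001/route/tribunal) claims are never citable.»
NOTHING below is cited: no `[cite: …]`, no `def`, no `Prop` fact.  Every declaration is [folklore] finite-dimensional calculus over K-U5 `ConstrainedCriticalMap`
(`exists_criticalMap_zero`, `fderiv_eq_of_identities`, `mulVecCLM`, `dotCLM`) and K-U2e `PolarizationTelescopingCompSlice.polarization_telescoping_comp_slice_of_tadpoleFree`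
BY NAME.  It asserts nothing about Bałaban's objects: the action `A` ∕ its gradient field `f`, the constraints, base points and nondegeneracy are PARAMETERS ∕
HYPOTHESES; K-U2e's composed-slice hypotheses along `U` and the functional-level tadpole binder `htad` REMAIN hypotheses of the plug (d1-formalise-ref F-d1ref28-1:
`htad` is OPEN for the literal pending W-4; an2 K-U4 `LogZFirstJet` gives its matrix shape).

WHY (row-D1 owner, gen 24; `ROUTE-O3.md` §3 W-2).  (i) HONEST DICTIONARY: for a gradient field `f = ∇A` the constrained critical branch `c ↦ U c` of K-U5 makes
the TREE-LEVEL EFFECTIVE ACTION `A ∘ U` (nested infimum in a chart) a `C²` function of the constraint value whose gradient is minus the multiplier and whose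
HESSIAN IS `effForm (H_c) C` — the Schur ∕ effective form of an2's `CompositionSingular` at the Jacobian `H_c` of `f` at `U c` — at EVERY constraint value
near the base: this is why K-U2d∕K-U2e's STEP family carries the form `effForm (K̃ (U B)) [Q̃₁(U B); τ₁]` (its physical corner).  (ii) THE (h-U) BINDER: K-U2e
asks for `U : (ι → ℝ) → (κ → ℝ)`, `U 0 = 0`, `C²` at `0`; §6 produces it as the SLICED critical map (averages prescribed, slice value `0`) from a `C²`
Euler–Lagrange field with nondegenerate sliced bordered matrix, and §7 re-issues K-U2e's tadpole-free END with `(U, hU0, hU)` replaced by that variational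
data.  What remains displayed in the END: an5's composed-slice hypotheses along `U`, `C²` regularity of the fine∕step functionals (K-U2f gives them from
primitive data), and `htad`.

WHAT (all [folklore]):
§5 **`fderiv_comp_criticalMap`** (`HasFDerivAt A (dotCLM (f (U c))) (U c)`, identities near `c` ⟹ `HasFDerivAt (A ∘ U) (−dotCLM (ω c)) c`),
   **`fderiv_fderiv_comp_criticalMap`** (`D²(A ∘ U)(c)[d][e] = (effForm H_c C *ᵥ d) ⬝ᵥ e`).
§6 `fromRows_one_zero_mulVec`, `mulVec_sumElim_zero`, **`exists_slicedCriticalMap_zero`** (`U 0 = 0`, `ω 0 = 0`, `C^k`, `f (U B) + [Q;τ]ᵀ ω B = 0`, `Q (U B) = B`,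
   `τ (U B) = 0` near `0`, `HasFDerivAt U (mulVecCLM (minOp H [Q; τ]).toCols₁) 0`).
§7 **`polarization_telescoping_comp_slice_of_variational`** (K-U2e's tadpole-free telescoping for the sliced critical map of level-1 variational data).
Provenance: β sub-cell, unit beta-an2 gen 24 (prover-b2b-balaban-beta-an2-g24-0), 2026-08-20.  NOT (SDF), NOT D1, NOT `BetaPertH`, NOT continuum, NOT Clay.
-/

noncomputable section

open Matrix Topology Filter
open scoped Matrix BigOperators
open Literature.MathematicalPhysics.QuantumFieldTheory.Balaban1983to89.Beta.Composition (kkt)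
open Literature.MathematicalPhysics.QuantumFieldTheory.Balaban1983to89.Beta.CompositionSingular (flucCov minOp minOpL effForm
  kkt_mul_blocks blocks_mul_kkt)
open Summit.QuantumFields.BalabanUV.Beta.ConstrainedCriticalMap

namespace Summit.QuantumFields.BalabanUV.Beta.ConstrainedCriticalMapEnvelope

/-! ## §5 The envelope identities: gradient and Hessian of the tree-level effective action `A ∘ U` -/

section Envelope

variable {κ μ : Type*} [Fintype κ] [Fintype μ] [DecidableEq κ] [DecidableEq μ]

/-- [folklore] **FIRST-ORDER ENVELOPE: `∇(A ∘ U)(c) = −ω(c)`.**  If `f` is the gradient of `A` at `U c` (`HasFDerivAt A (dotCLM (f (U c))) (U c)`), `U`, `ω`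
are differentiable at `c` and satisfy the two identities near `c`, then `fderiv (A ∘ U) c = −dotCLM (ω c)`: the multiplier is minus the gradient of
the effective action (constraint force). -/
theorem fderiv_comp_criticalMap {A : (κ → ℝ) → ℝ} {f : (κ → ℝ) → (κ → ℝ)} {C : Matrix μ κ ℝ} {U : (μ → ℝ) → (κ → ℝ)}
    {ω : (μ → ℝ) → (μ → ℝ)} {c : μ → ℝ} (hA : HasFDerivAt A (dotCLM (f (U c))) (U c)) (hU : DifferentiableAt ℝ U c)
    (hid : ∀ᶠ c' in 𝓝 c, f (U c') + Cᵀ *ᵥ ω c' = 0 ∧ C *ᵥ U c' = c') :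
    HasFDerivAt (A ∘ U) (-dotCLM (ω c)) c := by
  have hcomp : HasFDerivAt (A ∘ U) ((dotCLM (f (U c))).comp (fderiv ℝ U c)) c := hA.comp c hU.hasFDerivAt
  -- `C ∘ dU = id` from the second identity
  have hd2 : HasFDerivAt (fun c' => C *ᵥ U c') ((mulVecCLM C).comp (fderiv ℝ U c)) c :=
    (mulVecCLM C).hasFDerivAt.comp c hU.hasFDerivAt
  have hz2 : HasFDerivAt (fun c' => C *ᵥ U c') (ContinuousLinearMap.id ℝ (μ → ℝ)) c :=
    (hasFDerivAt_id c).congr_of_eventuallyEq (hid.mono fun c' h => h.2)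
  have e2 : (mulVecCLM C).comp (fderiv ℝ U c) = ContinuousLinearMap.id ℝ (μ → ℝ) := hd2.unique hz2
  have p2 : ∀ d, C *ᵥ fderiv ℝ U c d = d := fun d => by
    have := congrArg (fun L : (μ → ℝ) →L[ℝ] (μ → ℝ) => L d) e2
    simpa using this
  have hfc : f (U c) = -(Cᵀ *ᵥ ω c) := eq_neg_of_add_eq_zero_left (hid.self_of_nhds).1
  refine hcomp.congr_fderiv ?_
  ext d : 1
  simp only [ContinuousLinearMap.comp_apply, dotCLM_apply, FunLike.coe_neg, Pi.neg_apply, hfc,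
    Matrix.mulVec_transpose, neg_dotProduct]
  rw [← Matrix.dotProduct_mulVec, p2]

/-- [folklore] **SECOND-ORDER ENVELOPE: `Hess(A ∘ U)(c) = effForm(H_c, C)`** — THE STEP FAMILY'S FORM IS THE HESSIAN OF THE TREE-LEVEL EFFECTIVE ACTION.
If `f` is the gradient of `A` near the branch (`HasFDerivAt A (dotCLM (f (U c′))) (U c′)` for `c′` near `c`), `U`, `ω` are differentiable near `c` and
satisfy the two identities near `c`, `f` has Jacobian `H_c` at `U c`, and `kkt H_c C` is nonsingular, then
`D²(A ∘ U)(c)[d][e] = (effForm H_c C *ᵥ d) ⬝ᵥ e`. -/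
theorem fderiv_fderiv_comp_criticalMap {A : (κ → ℝ) → ℝ} {f : (κ → ℝ) → (κ → ℝ)} {C : Matrix μ κ ℝ} {U : (μ → ℝ) → (κ → ℝ)}
    {ω : (μ → ℝ) → (μ → ℝ)} {c : μ → ℝ} {Hc : Matrix κ κ ℝ}
    (hA : ∀ᶠ c' in 𝓝 c, HasFDerivAt A (dotCLM (f (U c'))) (U c'))
    (hU : ∀ᶠ c' in 𝓝 c, DifferentiableAt ℝ U c') (hω : DifferentiableAt ℝ ω c)
    (hf : HasFDerivAt f (mulVecCLM Hc) (U c))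
    (hid : ∀ᶠ c' in 𝓝 c, f (U c') + Cᵀ *ᵥ ω c' = 0 ∧ C *ᵥ U c' = c') (hkkt : IsUnit (kkt Hc C).det) (d e : μ → ℝ) :
    fderiv ℝ (fderiv ℝ (A ∘ U)) c d e = (effForm Hc C *ᵥ d) ⬝ᵥ e := by
  -- the first-order envelope identity holds at every point near `c`
  have hid' : ∀ᶠ c' in 𝓝 c, ∀ᶠ c'' in 𝓝 c', f (U c'') + Cᵀ *ᵥ ω c'' = 0 ∧ C *ᵥ U c'' = c'' :=
    hid.eventually_nhds
  have h1 : fderiv ℝ (A ∘ U) =ᶠ[𝓝 c] fun c' => -dotCLM (ω c') := by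
    filter_upwards [hA, hU, hid'] with c' hA' hU' hidc'
    exact (fderiv_comp_criticalMap hA' hU' hidc').fderiv
  -- differentiate it
  have h2 : HasFDerivAt (fun c' => -dotCLM (ω c')) (-((dotCLM : (μ → ℝ) →L[ℝ] (μ → ℝ) →L[ℝ] ℝ).comp (fderiv ℝ ω c))) c :=
    ((dotCLM : (μ → ℝ) →L[ℝ] (μ → ℝ) →L[ℝ] ℝ).hasFDerivAt.comp c hω.hasFDerivAt).neg
  rw [(h2.congr_of_eventuallyEq h1).fderiv]
  -- `dω = −effForm`
  have hUc : DifferentiableAt ℝ U c := hU.self_of_nhds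
  have hωd := (fderiv_eq_of_identities hUc hω hf hid hkkt).2
  rw [hωd]
  simp

end Envelope


/-! ## §6 The sliced critical map: averaging rows with prescribed value `B`, gauge-slice rows with value `0` -/

section Sliced

variable {κ μ ρ : Type*} [Fintype κ] [Fintype μ] [Fintype ρ] [DecidableEq κ] [DecidableEq μ] [DecidableEq ρ]

omit [Fintype κ] [Fintype ρ] [DecidableEq κ] [DecidableEq ρ] in
/-- [folklore] The section `B ↦ (B, 0)` of the constraint values is `fromRows 1 0 *ᵥ B`. -/
theorem fromRows_one_zero_mulVec (B : μ → ℝ) :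
    fromRows (1 : Matrix μ μ ℝ) (0 : Matrix ρ μ ℝ) *ᵥ B = Sum.elim B 0 := by
  rw [fromRows_mulVec, Matrix.one_mulVec, Matrix.zero_mulVec]

omit [Fintype κ] [DecidableEq κ] [DecidableEq μ] [DecidableEq ρ] in
/-- [folklore] `A *ᵥ (B, 0) = A.toCols₁ *ᵥ B`. -/
theorem mulVec_sumElim_zero (A : Matrix κ (μ ⊕ ρ) ℝ) (B : μ → ℝ) : A *ᵥ Sum.elim B 0 = A.toCols₁ *ᵥ B := by
  conv_lhs => rw [← fromCols_toCols A]
  rw [fromCols_mulVec_sumElim, Matrix.mulVec_zero, add_zero]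

/-- [folklore] **THE SLICED CRITICAL MAP AT THE TRIVIAL BACKGROUND** (the object `U` of K-U2e for honest data).  Euler–Lagrange field `f` of class `C^k`
(`k ≠ 0`) at `0` with Jacobian `H` and `f 0 = 0`; averaging constraint `Q : Matrix μ κ ℝ` and gauge slice `τ : Matrix ρ κ ℝ` with NONDEGENERATE sliced
bordered matrix `IsUnit (kkt H [Q; τ]).det`.  Then there is `U : (μ → ℝ) → (κ → ℝ)` (and a multiplier `ω`) with `U 0 = 0`, `U`, `ω` of class `C^k` at
`0`, and for `B` near `0`: `f (U B) + [Q; τ]ᵀ ω B = 0`, `Q (U B) = B` (prescribed averages), `τ (U B) = 0` (on the slice); `dU(0) = (minOp H [Q; τ]).toCols₁`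
(the averaging columns of the minimiser operator). -/
theorem exists_slicedCriticalMap_zero {k : WithTop ℕ∞} (hk : k ≠ 0) (f : (κ → ℝ) → (κ → ℝ)) (Q : Matrix μ κ ℝ) (τ : Matrix ρ κ ℝ)
    (H : Matrix κ κ ℝ) (hf : ContDiffAt ℝ k f 0) (hH : HasFDerivAt f (mulVecCLM H) 0) (hf0 : f 0 = 0)
    (hkkt : IsUnit (kkt H (fromRows Q τ)).det) :
    ∃ U : (μ → ℝ) → (κ → ℝ), ∃ ω : (μ → ℝ) → (μ ⊕ ρ → ℝ),
      U 0 = 0 ∧ ω 0 = 0 ∧ ContDiffAt ℝ k U 0 ∧ ContDiffAt ℝ k ω 0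
      ∧ (∀ᶠ B in 𝓝 (0 : μ → ℝ), f (U B) + (fromRows Q τ)ᵀ *ᵥ ω B = 0 ∧ Q *ᵥ U B = B ∧ τ *ᵥ U B = 0)
      ∧ HasFDerivAt U (mulVecCLM (minOp H (fromRows Q τ)).toCols₁) 0 := by
  obtain ⟨U, ω, hU0, hω0, hUk, hωk, hid, -, hUd, -⟩ := exists_criticalMap_zero hk f (fromRows Q τ) H hf hH hf0 hkkt
  set s : (μ → ℝ) →L[ℝ] (μ ⊕ ρ → ℝ) := mulVecCLM (fromRows (1 : Matrix μ μ ℝ) (0 : Matrix ρ μ ℝ)) with hs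
  have hs_apply : ∀ B, s B = Sum.elim B 0 := fun B => by rw [hs, mulVecCLM_apply, fromRows_one_zero_mulVec]
  have hs0 : s 0 = 0 := map_zero s
  have hUk' : ContDiffAt ℝ k U (s 0) := by rw [hs0]; exact hUk
  have hωk' : ContDiffAt ℝ k ω (s 0) := by rw [hs0]; exact hωk
  have hUd' : HasFDerivAt U (mulVecCLM (minOp H (fromRows Q τ))) (s 0) := by rw [hs0]; exact hUd
  have ht : Tendsto s (𝓝 0) (𝓝 0) := by simpa only [hs0] using s.continuous.tendsto 0
  refine ⟨fun B => U (s B), fun B => ω (s B), ?_, ?_, ?_, ?_, ?_, ?_⟩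
  · show U (s 0) = 0
    rw [hs0, hU0]
  · show ω (s 0) = 0
    rw [hs0, hω0]
  · exact hUk'.comp 0 s.contDiff.contDiffAt
  · exact hωk'.comp 0 s.contDiff.contDiffAt
  · filter_upwards [ht.eventually hid] with B hB
    simp only [hs_apply] at hB ⊢
    obtain ⟨h1, h2⟩ := hB
    rw [fromRows_mulVec] at h2
    refine ⟨h1, ?_, ?_⟩
    · have e := congrArg (fun g : μ ⊕ ρ → ℝ => g ∘ Sum.inl) h2
      simpa only [Sum.elim_comp_inl] using e
    · have e := congrArg (fun g : μ ⊕ ρ → ℝ => g ∘ Sum.inr) h2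
      simpa only [Sum.elim_comp_inr] using e
  · have h := hUd'.comp 0 s.hasFDerivAt
    refine h.congr_fderiv ?_
    ext B : 1
    simp only [ContinuousLinearMap.comp_apply, mulVecCLM_apply, hs_apply, mulVec_sumElim_zero]

end Sliced

/-! ## §7 The plug into K-U2e: (h-U) from variational data -/

section Plug

open Literature.MathematicalPhysics.QuantumFieldTheory.Balaban1983to89.Beta (Family ConstrainedGaussian polarization)
open Summit.QuantumFields.BalabanUV.Beta.PolarizationTelescopingCompSlice (polarization_telescoping_comp_slice_of_tadpoleFree)

variable {ι κ ρ : Type*} [Fintype ι] [DecidableEq ι] [Fintype κ] [DecidableEq κ] [Fintype ρ] [DecidableEq ρ] {n n₁ n₂ r₁ r₂ : ℕ}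

/-- [folklore] **K-U2e WITH (h-U) DISCHARGED FROM VARIATIONAL DATA.**  Replace K-U2e's parameters `(U, hU0, hU)` by: a level-1 Euler–Lagrange field `f₁`
of class `C²` at `0` with Jacobian `H₁`, `f₁ 0 = 0`, a (background-independent) coarse averaging `Q₂c : Matrix ι κ ℝ` on level-1 configurations and a
gauge slice `τ₂c` with `IsUnit (kkt H₁ [Q₂c; τ₂c]).det`.  Then THE SLICED CRITICAL MAP `U` of §6 (level-1 configuration with prescribed coarse
averages `B` on the slice, `U 0 = 0`, `C²` at `0`) satisfies K-U2e's tadpole-free telescoping identity under K-U2e's remaining hypotheses along `U`. -/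
theorem polarization_telescoping_comp_slice_of_variational
    (f₁ : (κ → ℝ) → (κ → ℝ)) (H₁ : Matrix κ κ ℝ) (Q₂c : Matrix ι κ ℝ) (τ₂c : Matrix ρ κ ℝ)
    (hf₁ : ContDiffAt ℝ 2 f₁ 0) (hH₁ : HasFDerivAt f₁ (mulVecCLM H₁) 0) (hf₁0 : f₁ 0 = 0)
    (hkkt₁ : IsUnit (kkt H₁ (fromRows Q₂c τ₂c)).det)
    (Kt : (κ → ℝ) → Matrix (Fin n) (Fin n) ℝ) (Q₁t : (κ → ℝ) → Matrix (Fin n₁) (Fin n) ℝ) (Q₂t : (κ → ℝ) → Matrix (Fin n₂) (Fin n₁) ℝ)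
    (W₁t : (κ → ℝ) → Matrix (Fin n) (Fin r₁) ℝ) (τ₁ : Matrix (Fin r₁) (Fin n) ℝ) (τ₂ : Matrix (Fin r₂) (Fin n₁) ℝ)
    (e₂ : Fin (n₂ + (r₂ + r₁)) ≃ Fin n₂ ⊕ (Fin r₂ ⊕ Fin r₁)) (e₁ : Fin (n₁ + r₁) ≃ Fin n₁ ⊕ Fin r₁) (es : Fin (n₂ + r₂) ≃ Fin n₂ ⊕ Fin r₂) :
    ∃ U : (ι → ℝ) → (κ → ℝ), U 0 = 0 ∧ ContDiffAt ℝ 2 U 0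
      ∧ (∀ᶠ B in 𝓝 (0 : ι → ℝ), Q₂c *ᵥ U B = B ∧ τ₂c *ᵥ U B = 0)
      ∧ HasFDerivAt U (mulVecCLM (minOp H₁ (fromRows Q₂c τ₂c)).toCols₁) 0
      ∧ ((∀ᶠ B in 𝓝 (0 : ι → ℝ), Kt (U B) * W₁t (U B) = 0) → (∀ᶠ B in 𝓝 (0 : ι → ℝ), (Kt (U B))ᵀ * W₁t (U B) = 0) →
          (∀ᶠ B in 𝓝 (0 : ι → ℝ), Q₁t (U B) * W₁t (U B) = 0) → (∀ᶠ B in 𝓝 (0 : ι → ℝ), IsUnit (τ₁ * W₁t (U B)).det) →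
          (∀ᶠ B in 𝓝 (0 : ι → ℝ), IsUnit (kkt (Kt (U B)) (fromRows (Q₁t (U B)) τ₁)).det) →
          (∀ᶠ B in 𝓝 (0 : ι → ℝ), IsUnit (kkt (effForm (Kt (U B)) (fromRows (Q₁t (U B)) τ₁)).toBlocks₁₁ (fromRows (Q₂t (U B)) τ₂)).det) →
          ContDiffAt ℝ 2 (Family.logZ (fun B₁ => ConstrainedGaussian.mk ((fromRows (Q₁t B₁) τ₁).submatrix e₁ id) (Kt B₁) : Family κ n (n₁ + r₁))) 0 →
          ContDiffAt ℝ 2 (Family.logZ (fun B => ConstrainedGaussian.mk ((fromRows (Q₂t (U B)) τ₂).submatrix es id)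
            (effForm (Kt (U B)) (fromRows (Q₁t (U B)) τ₁)).toBlocks₁₁ : Family ι n₁ (n₂ + r₂))) 0 →
          fderiv ℝ (Family.logZ (fun B₁ => ConstrainedGaussian.mk ((fromRows (Q₁t B₁) τ₁).submatrix e₁ id) (Kt B₁) : Family κ n (n₁ + r₁))) 0 = 0 →
          ∀ i j : ι,
            polarization (fun B => ConstrainedGaussian.mk ((fromRows (Q₂t (U B) * Q₁t (U B)) (fromRows (τ₂ * Q₁t (U B)) τ₁)).submatrix e₂ id)
                (Kt (U B)) : Family ι n (n₂ + (r₂ + r₁))) i j =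
              (∑ a, ∑ b, (fderiv ℝ U 0 (Pi.single i 1) a * fderiv ℝ U 0 (Pi.single j 1) b) *
                  polarization (fun B₁ => ConstrainedGaussian.mk ((fromRows (Q₁t B₁) τ₁).submatrix e₁ id) (Kt B₁) : Family κ n (n₁ + r₁)) a b)
                + polarization (fun B => ConstrainedGaussian.mk ((fromRows (Q₂t (U B)) τ₂).submatrix es id)
                    (effForm (Kt (U B)) (fromRows (Q₁t (U B)) τ₁)).toBlocks₁₁ : Family ι n₁ (n₂ + r₂)) i j) := by
  obtain ⟨U, ω, hU0, -, hUk, -, hid, hUd⟩ :=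
    exists_slicedCriticalMap_zero (k := 2) (by norm_num) f₁ Q₂c τ₂c H₁ hf₁ hH₁ hf₁0 hkkt₁
  refine ⟨U, hU0, hUk, hid.mono fun B hB => ⟨hB.2.1, hB.2.2⟩, hUd, ?_⟩
  intro hKW hKtW hQW hT h1 h2 hf hφ htad i j
  exact polarization_telescoping_comp_slice_of_tadpoleFree Kt Q₁t Q₂t W₁t τ₁ τ₂ e₂ e₁ es U hU0 hUk hKW hKtW hQW hT h1 h2 hf hφ
    htad i j

end Plug

end Summit.QuantumFields.BalabanUV.Beta.ConstrainedCriticalMapEnvelope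

end
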